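import Mathlib.RingTheory.RootsOfUnity.Complex
import Mathlib.Analysis.SpecialFunctions.Pow.Real
import Mathlib.Analysis.SpecialFunctions.Pow.Continuity
import Mathlib.Analysis.SpecialFunctions.Complex.Arg
import Mathlib.NumberTheory.Divisors
import Mathlib.Topology.Algebra.InfiniteSum.Real
import Mathlib.Topology.Algebra.InfiniteSum.Constructions
import Mathlib.Analysis.Normed.Group.InfiniteSum
import Mathlib.Analysis.SpecificLimits.Basic
import Mathlib.Analysis.PSeries
import Mathlib.Data.Nat.Prime.Infinite
import Mathlib.Data.Set.Finite.Basic
import HarnessLib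

/-!
# Discrete Wolff data: a positive atomic measure on the disc, discrete in the disc, all of whose
# holomorphic moments vanish («divisor rings»)

Cell `rh-split`, lane (xii) SCREW side, gen-15 POSTSCRIPT (census V106 «one-circle blindness»).
ζ-free and RH-free: this file is pure analysis/combinatorics.

## What is constructed

For every `R > 1` a countable family of atoms `w i` in the open annulus `1 < ‖w i‖ < R` with positive
summable weights `α i` such that

* every holomorphic moment vanishes: `Σ α i · (w i)^k = 0` for all `k ≥ 1`
  (the hypothesis (W) of B16's blind model, `ScrewLatticeWolffData.exists_wolffData`);
* NEW: the atoms are DISCRETE INSIDE the annulus — for every `ρ < R` only finitely many atoms have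
  `‖w i‖ ≤ ρ`; they accumulate only on the outer circle `‖w‖ = R`.

Fed to B16's model (`ScrewLatticeWolffModel`, abscissae `Re κ = log ‖w‖ / h`) this gives a BLIND
real-positive-weight configuration (uniform floor, ceiling and `LPSD(h)` on the lattice `hℕ`) whose
abscissae have, below every `σ < σ*`, only finitely many members: its aliased wall is the ONE circle
`‖s‖ = e^{-σ* h}` — finite length, Hausdorff dimension `1`.  Hence the zero-LENGTH threshold of the thin-wall
hypothesis `TW(h)` (`ScrewLatticeThinWall`) is SHARP inside the kernel's class: positive finite length already
blinds (B16′ «one-circle Wolff wall»; closes census items V106/V107 of `cards/SPLIT-screw-bridge.md` §20).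

## The construction («divisor rings», `q = 1/16`)

Seed: the two atoms `±q` of weight `1/2` (moments `[2 ∣ k] q^k`).  For `n ≥ 2` put recursively
`E n := [2 ∣ n] qⁿ + Σ_{d ∣ n, 2 ≤ d < n} ‖c d‖ q^{n/d} u_d^{n/d}` (`u_d := c d / ‖c d‖`) and `c n := -E n / q`;
ring `n` consists of `n` equally spaced atoms on the circle of radius `q^{1/n}`, rotated so that the `n`-th
power of their direction is `u_n`, each of weight `‖c n‖ / n`.  Ring `d` contributes `‖c d‖ q^{k/d} u_d^{k/d}`
at the frequencies `k` divisible by `d` and nothing elsewhere, so the total `k`-th moment is `E k + q·c k = 0`.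
Strong induction gives `‖c n‖ ≤ 1/n²` (total mass `< 2`); the ring `2p` (`p` an odd prime) has
`c (2p) = q^p - q^{2p-1} ≠ 0`, so infinitely many rings are present and the radii `q^{1/n} ↑ 1`.  Replacing every
atom by its `M` `M`-th roots (weights `/M`) keeps all moments zero and pushes the atoms into `q^{1/M} ≤ ‖ζ‖ < 1`;
scaling by `R` lands them in the annulus.  (Numerical replay: 40 202 atoms, `max_k |moment_k| = 1.1e-18`.)

Main theorem: `exists_discreteWolffData`.

LANE CARVE (3 parts, one namespace `…ScrewWolffDiscreteData`): part A = §§1–4 (scalars, the ring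
coefficients `coef`, the bound `‖c n‖ ≤ 1/n²`, infinitely many live rings); part B = §§5–7 (radii, roots of
unity, atoms, weights, summability); part C = §§8–10 (vanishing moments, discreteness, `exists_discreteWolffData`).
-/

set_option linter.dupNamespace false

namespace Summit.RiemannHypothesis.RiemannHypothesis.Theorems.Splittings.ScrewWolffDiscreteData

open Complex Finset Filter Topology

noncomputable section


/-! ## 1. Scalars: `q`, unit directions, ring terms -/

/-- The base ratio `q = 1/16`. -/
def q : ℝ := 1 / 16

/-- The base ratio `q = 1/16` is positive. -/
theorem q_pos : 0 < q := by norm_num [q]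

/-- The base ratio `q = 1/16` is less than one. -/
theorem q_lt_one : q < 1 := by norm_num [q]

/-- The base ratio `q` is non-zero. -/
theorem q_ne_zero : q ≠ 0 := q_pos.ne'

/-- Unit direction of a complex number (`1` at the origin). -/
def udir (z : ℂ) : ℂ := if z = 0 then 1 else z / (‖z‖ : ℂ)

/-- The unit direction `udir z` always has norm one (it is `1` at `z = 0`). -/
theorem norm_udir (z : ℂ) : ‖udir z‖ = 1 := by
  unfold udir
  split_ifs with h
  · simp
  · rw [norm_div, Complex.norm_real, Real.norm_eq_abs, abs_norm, div_self (norm_ne_zero_iff.mpr h)]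

/-- Polar factorisation: `‖z‖ · udir z = z`. -/
theorem norm_mul_udir (z : ℂ) : (‖z‖ : ℂ) * udir z = z := by
  unfold udir
  split_ifs with h
  · simp [h]
  · have : (‖z‖ : ℂ) ≠ 0 := by exact_mod_cast norm_ne_zero_iff.mpr h
    field_simp

/-- `exp(i·arg u) = u` for a unit direction. -/
theorem exp_arg_udir (z : ℂ) : Complex.exp (arg (udir z) * I) = udir z := by
  have h := norm_mul_exp_arg_mul_I (udir z)
  rwa [norm_udir, Complex.ofReal_one, one_mul] at h

/-- The contribution of a ring with coefficient `c` at multiplicity `m`: `‖c‖ q^m (udir c)^m`. -/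
def term (c : ℂ) (m : ℕ) : ℂ := (‖c‖ : ℂ) * (q : ℂ) ^ m * udir c ^ m

/-- The norm of the ring contribution `term c m` is `‖c‖ q^m`. -/
theorem norm_term (c : ℂ) (m : ℕ) : ‖term c m‖ = ‖c‖ * q ^ m := by
  rw [term, norm_mul, norm_mul, norm_pow, norm_pow, norm_udir, one_pow, mul_one, Complex.norm_real,
    Complex.norm_real, Real.norm_eq_abs, Real.norm_eq_abs, abs_norm, abs_of_pos q_pos]

/-- A dead ring (`c = 0`) contributes nothing. -/
theorem term_zero (m : ℕ) : term 0 m = 0 := by simp [term]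

/-- At its base frequency a ring contributes `q · c`. -/
theorem term_one (c : ℂ) : term c 1 = (q : ℂ) * c := by
  rw [term, pow_one, pow_one, mul_right_comm, norm_mul_udir, mul_comm]

/-- The seed moment at frequency `n`: `[2 ∣ n] qⁿ`. -/
def seedMom (n : ℕ) : ℂ := if 2 ∣ n then (q : ℂ) ^ n else 0

/-- The seed moments are bounded by `q^n` in norm. -/
theorem norm_seedMom_le (n : ℕ) : ‖seedMom n‖ ≤ q ^ n := by
  unfold seedMom
  split_ifs
  · rw [norm_pow, Complex.norm_real, Real.norm_eq_abs, abs_of_pos q_pos]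
  · rw [norm_zero]; exact pow_nonneg q_pos.le n

/-! ## 2. The ring coefficients (well-founded recursion over proper divisors) -/

/-- The ring coefficients `c n` (`c 0 = c 1 = 0`; for `n ≥ 2`,
`c n = -([2∣n] qⁿ + Σ_{d ∣ n, 2 ≤ d < n} ‖c d‖ q^{n/d} (udir (c d))^{n/d}) / q`). -/
def coef : ℕ → ℂ
  | n => if n < 2 then 0 else
      -((seedMom n + ∑ d ∈ (Nat.properDivisors n).attach,
          (have := (Nat.mem_properDivisors.1 d.2).2
           if 2 ≤ d.1 then term (coef d.1) (n / d.1) else 0)) / q)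
termination_by n => n
decreasing_by exact (Nat.mem_properDivisors.1 d.2).2

/-- The sum over the proper divisors `d ≥ 2` of `n`. -/
def ringSum (n : ℕ) : ℂ := ∑ d ∈ Nat.properDivisors n, if 2 ≤ d then term (coef d) (n / d) else 0

/-- There are no rings below level two: `coef n = 0` for `n < 2`. -/
theorem coef_of_lt_two {n : ℕ} (hn : n < 2) : coef n = 0 := by
  rw [coef.eq_def]; simp [hn]

/-- The defining recursion of the ring coefficients, unfolded at `n ≥ 2`. -/
theorem coef_eq {n : ℕ} (hn : 2 ≤ n) : coef n = -((seedMom n + ringSum n) / q) := by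
  rw [coef.eq_def, if_neg (by omega), ringSum]
  congr 3
  exact Finset.sum_attach (Nat.properDivisors n) (fun d ↦ if 2 ≤ d then term (coef d) (n / d) else 0)

/-- A live ring has level at least two. -/
theorem coef_ne_zero_two_le {n : ℕ} (hn : coef n ≠ 0) : 2 ≤ n := by
  by_contra h
  exact hn (coef_of_lt_two (by omega))

/-- `q · c n = -(seedMom n + ringSum n)` for `n ≥ 2`. -/
theorem q_mul_coef {n : ℕ} (hn : 2 ≤ n) : (q : ℂ) * coef n = -(seedMom n + ringSum n) := by
  rw [coef_eq hn]
  have : (q : ℂ) ≠ 0 := by exact_mod_cast q_ne_zero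
  field_simp

/-- **Moment cancellation at base frequency `j ≥ 1`**:
`[2∣j] q^j + Σ_{d ∣ j, 2 ≤ d} term (c d) (j/d) = 0` (the `d = j` term is `q · c j`). -/
theorem seedMom_add_sum_divisors (j : ℕ) (hj : 1 ≤ j) :
    seedMom j + ∑ d ∈ Nat.divisors j, (if 2 ≤ d then term (coef d) (j / d) else 0) = 0 := by
  rcases Nat.lt_or_ge j 2 with hj2 | hj2
  · have hj1 : j = 1 := by omega
    subst hj1
    simp [seedMom]
  · rw [← Nat.insert_self_properDivisors (by omega), Finset.sum_insert Nat.self_notMem_properDivisors,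
      if_pos hj2, Nat.div_self (by omega), term_one, q_mul_coef hj2, ringSum]
    ring

/-! ## 3. The bound `‖c n‖ ≤ 1/n²` -/

/-- Arithmetic bound used for the ring sum: `m² · 2^(m+4) ≤ 16^m` for `m ≥ 2`. -/
theorem nat_ineq_ring (m : ℕ) (hm : 2 ≤ m) : m ^ 2 * 2 ^ (m + 4) ≤ 16 ^ m := by
  induction m, hm using Nat.le_induction with
  | base => norm_num
  | succ m hm ih =>
    have h1 : (m + 1) ^ 2 ≤ 4 * m ^ 2 := by nlinarith
    calc (m + 1) ^ 2 * 2 ^ (m + 1 + 4) = (m + 1) ^ 2 * 2 ^ (m + 4) * 2 := by ring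
      _ ≤ 4 * m ^ 2 * 2 ^ (m + 4) * 2 := by gcongr
      _ = 8 * (m ^ 2 * 2 ^ (m + 4)) := by ring
      _ ≤ 8 * 16 ^ m := by gcongr
      _ ≤ 16 ^ (m + 1) := by rw [pow_succ]; omega

/-- Arithmetic bound used for the seed term: `64 n² ≤ 16^n` for `n ≥ 2`. -/
theorem nat_ineq_seed (n : ℕ) (hn : 2 ≤ n) : 64 * n ^ 2 ≤ 16 ^ n := by
  induction n, hn using Nat.le_induction with
  | base => norm_num
  | succ m hm ih =>
    have h1 : (m + 1) ^ 2 ≤ 4 * m ^ 2 := by nlinarith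
    calc 64 * (m + 1) ^ 2 ≤ 64 * (4 * m ^ 2) := by gcongr
      _ = 4 * (64 * m ^ 2) := by ring
      _ ≤ 4 * 16 ^ m := by gcongr
      _ ≤ 16 ^ (m + 1) := by rw [pow_succ]; omega

/-- `m² q^m ≤ q (1/2)^m` for `m ≥ 2`. -/
theorem sq_mul_q_pow_le (m : ℕ) (hm : 2 ≤ m) : (m : ℝ) ^ 2 * q ^ m ≤ q * (1 / 2) ^ m := by
  have h := nat_ineq_ring m hm
  have h' : (m : ℝ) ^ 2 * 2 ^ (m + 4) ≤ 16 ^ m := by exact_mod_cast h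
  rw [q, one_div_pow, one_div_pow, pow_add] at *
  rw [mul_one_div, one_div_mul_one_div_rev, div_le_div_iff₀ (by positivity) (by positivity), one_mul]
  nlinarith [h']

/-- `q^n ≤ q/(4n²)` for `n ≥ 2`. -/
theorem q_pow_le (n : ℕ) (hn : 2 ≤ n) : q ^ n ≤ q * (1 / (4 * (n : ℝ) ^ 2)) := by
  have h' : (64 : ℝ) * (n : ℝ) ^ 2 ≤ 16 ^ n := by exact_mod_cast nat_ineq_seed n hn
  have hn' : (0 : ℝ) < n := by exact_mod_cast (show 0 < n by omega)
  rw [q, one_div_pow, mul_one_div, div_div, div_le_div_iff₀ (by positivity) (by positivity), one_mul, one_mul]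
  nlinarith [h']

/-- The geometric tail `Σ_{2 ≤ m ≤ n} (1/2)^m ≤ 1/2`. -/
theorem sum_half_pow_le (n : ℕ) :
    ∑ m ∈ Finset.range (n + 1), (if 2 ≤ m then (1 / 2 : ℝ) ^ m else 0) ≤ 1 / 2 := by
  rcases Nat.lt_or_ge n 1 with hn | hn
  · have : n = 0 := by omega
    subst this
    norm_num
  · have hsplit : ∑ m ∈ Finset.range (n + 1), (if 2 ≤ m then (1 / 2 : ℝ) ^ m else 0)
        = ∑ m ∈ Finset.range (n + 1), (1 / 2 : ℝ) ^ m - 3 / 2 := by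
      have h2 : 2 ≤ n + 1 := by omega
      rw [← Finset.sum_range_add_sum_Ico _ h2, ← Finset.sum_range_add_sum_Ico (fun m ↦ (1 / 2 : ℝ) ^ m) h2]
      rw [Finset.sum_congr rfl (fun m (hm : m ∈ Finset.Ico 2 (n + 1)) ↦
        (if_pos (Finset.mem_Ico.1 hm).1 : (if 2 ≤ m then (1 / 2 : ℝ) ^ m else 0) = (1 / 2 : ℝ) ^ m))]
      norm_num [Finset.sum_range_succ]
    rw [hsplit]
    linarith [sum_geometric_two_le (n + 1)]

/-- **The mass bound** `‖c n‖ ≤ 1/n²` (all `n`; recall `1/0² = 0` in Lean and `c 0 = 0`). -/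
theorem norm_coef_le (n : ℕ) : ‖coef n‖ ≤ 1 / (n : ℝ) ^ 2 := by
  induction n using Nat.strong_induction_on with
  | _ n ih =>
    rcases Nat.lt_or_ge n 2 with hn | hn
    · rw [coef_of_lt_two hn, norm_zero]; positivity
    have hn0 : (0 : ℝ) < n := by exact_mod_cast (show 0 < n by omega)
    -- each summand of `ringSum n`, divided by `q`, is at most `(1/n²)·F(n/d)`
    set F : ℕ → ℝ := fun m ↦ if 2 ≤ m then (1 / 2 : ℝ) ^ m else 0 with hF
    have hF0 : ∀ m, 0 ≤ F m := fun m ↦ by simp only [hF]; split_ifs <;> positivity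
    have hsummand : ∀ d ∈ Nat.properDivisors n,
        ‖(if 2 ≤ d then term (coef d) (n / d) else 0)‖ ≤ q * ((1 / (n : ℝ) ^ 2) * F (n / d)) := by
      intro d hd
      obtain ⟨hdn, hdlt⟩ := Nat.mem_properDivisors.1 hd
      split_ifs with h2
      · set m := n / d with hm
        have hdm : d * m = n := Nat.mul_div_cancel' hdn
        have hm2 : 2 ≤ m := by
          by_contra hlt
          interval_cases m <;> omega
        have hd0 : (0 : ℝ) < d := by exact_mod_cast (show 0 < d by omega)
        have hm0 : (0 : ℝ) < m := by exact_mod_cast (show 0 < m by omega)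
        have hdm' : (d : ℝ) * m = n := by exact_mod_cast hdm
        rw [norm_term]
        have ihd := ih d hdlt
        have hFm : F m = (1 / 2 : ℝ) ^ m := by simp [hF, hm2]
        rw [hFm]
        calc ‖coef d‖ * q ^ m ≤ 1 / (d : ℝ) ^ 2 * q ^ m :=
              mul_le_mul_of_nonneg_right ihd (pow_nonneg q_pos.le m)
          _ = 1 / (n : ℝ) ^ 2 * ((m : ℝ) ^ 2 * q ^ m) := by rw [← hdm']; field_simp
          _ ≤ 1 / (n : ℝ) ^ 2 * (q * (1 / 2) ^ m) :=
              mul_le_mul_of_nonneg_left (sq_mul_q_pow_le m hm2) (by positivity)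
          _ = q * (1 / (n : ℝ) ^ 2 * (1 / 2) ^ m) := by ring
      · rw [norm_zero]; exact mul_nonneg q_pos.le (mul_nonneg (by positivity) (hF0 _))
    -- sum of the bounds: `Σ_{d ∈ propDiv n} F(n/d) ≤ Σ_{d ∣ n} F(n/d) = Σ_{d ∣ n} F d ≤ Σ_{m ≤ n} F m ≤ 1/2`
    have hsumF : ∑ d ∈ Nat.properDivisors n, F (n / d) ≤ 1 / 2 := by
      calc ∑ d ∈ Nat.properDivisors n, F (n / d) ≤ ∑ d ∈ Nat.divisors n, F (n / d) :=
            Finset.sum_le_sum_of_subset_of_nonneg (Nat.properDivisors_subset_divisors) fun _ _ _ ↦ hF0 _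
        _ = ∑ d ∈ Nat.divisors n, F d := Nat.sum_div_divisors n F
        _ ≤ ∑ m ∈ Finset.range (n + 1), F m :=
            Finset.sum_le_sum_of_subset_of_nonneg (fun d hd ↦ Finset.mem_range.2
              (Nat.lt_succ_of_le (Nat.divisor_le hd))) fun _ _ _ ↦ hF0 _
        _ ≤ 1 / 2 := sum_half_pow_le n
    -- assemble
    rw [coef_eq hn, norm_neg, norm_div, Complex.norm_real, Real.norm_eq_abs, abs_of_pos q_pos,
      div_le_iff₀ q_pos]
    have h34 : 1 / (4 * (n : ℝ) ^ 2) + 1 / (n : ℝ) ^ 2 * (1 / 2) ≤ 1 / (n : ℝ) ^ 2 := by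
      have : 1 / (4 * (n : ℝ) ^ 2) + 1 / (n : ℝ) ^ 2 * (1 / 2) = (3 / 4) * (1 / (n : ℝ) ^ 2) := by
        field_simp; ring
      rw [this]
      have : 0 ≤ 1 / (n : ℝ) ^ 2 := by positivity
      nlinarith
    calc ‖seedMom n + ringSum n‖ ≤ ‖seedMom n‖ + ‖ringSum n‖ := norm_add_le _ _
      _ ≤ q ^ n + ∑ d ∈ Nat.properDivisors n, ‖(if 2 ≤ d then term (coef d) (n / d) else 0)‖ :=
          add_le_add (norm_seedMom_le n) (norm_sum_le _ _)
      _ ≤ q * (1 / (4 * (n : ℝ) ^ 2)) + ∑ d ∈ Nat.properDivisors n, q * ((1 / (n : ℝ) ^ 2) * F (n / d)) :=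
          add_le_add (q_pow_le n hn) (Finset.sum_le_sum hsummand)
      _ = q * (1 / (4 * (n : ℝ) ^ 2) + (1 / (n : ℝ) ^ 2) * ∑ d ∈ Nat.properDivisors n, F (n / d)) := by
          rw [mul_add, Finset.mul_sum, Finset.mul_sum]
      _ ≤ q * (1 / (4 * (n : ℝ) ^ 2) + (1 / (n : ℝ) ^ 2) * (1 / 2)) :=
          mul_le_mul_of_nonneg_left (add_le_add le_rfl (mul_le_mul_of_nonneg_left hsumF
            (by positivity : (0 : ℝ) ≤ 1 / (n : ℝ) ^ 2))) q_pos.le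
      _ ≤ q * (1 / (n : ℝ) ^ 2) := mul_le_mul_of_nonneg_left h34 q_pos.le
      _ = 1 / (n : ℝ) ^ 2 * q := mul_comm _ _

/-- The masses are summable: `Σ_n ‖c n‖ < ∞`. -/
theorem summable_norm_coef : Summable (fun n : ℕ ↦ ‖coef n‖) :=
  Summable.of_nonneg_of_le (fun _ ↦ norm_nonneg _) norm_coef_le
    (Real.summable_one_div_nat_pow.mpr one_lt_two)

/-! ## 4. Infinitely many rings: `c (2p) ≠ 0` for odd primes `p` -/

/-- The first ring coefficient is `coef 2 = -q`. -/
theorem coef_two : coef 2 = -(q : ℂ) := by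
  have hq : (q : ℂ) ≠ 0 := by exact_mod_cast q_ne_zero
  rw [coef_eq le_rfl, ringSum, Nat.prime_two.properDivisors, Finset.sum_singleton, if_neg (by norm_num),
    add_zero, seedMom, if_pos (dvd_refl 2), pow_two, mul_div_assoc, div_self hq, mul_one]

/-- Odd prime levels carry no ring: `coef p = 0`. -/
theorem coef_prime {p : ℕ} (hp : p.Prime) (hodd : ¬ 2 ∣ p) : coef p = 0 := by
  rw [coef_eq hp.two_le, ringSum, hp.properDivisors]
  simp [seedMom, hodd]

/-- The direction of the level-two ring coefficient is `-1`. -/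
theorem udir_coef_two : udir (coef 2) = -1 := by
  have hq : (q : ℂ) ≠ 0 := by exact_mod_cast q_ne_zero
  rw [udir, coef_two, if_neg (neg_ne_zero.mpr hq), norm_neg, Complex.norm_real, Real.norm_eq_abs,
    abs_of_pos q_pos, neg_div, div_self hq]

/-- The proper divisors of `2p` other than `2` contribute nothing (`p` an odd prime). -/
theorem ringSum_two_mul_prime {p : ℕ} (hp : p.Prime) (hodd : ¬ 2 ∣ p) :
    ringSum (2 * p) = term (coef 2) p := by
  have hp2 : 2 < p := by
    rcases hp.eq_one_or_self_of_dvd 2 |> fun h ↦ (em (2 ∣ p)) with h | h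
    · exact absurd h hodd
    · have := hp.two_le; omega
  rw [ringSum, Finset.sum_eq_single 2]
  · rw [if_pos le_rfl, Nat.mul_div_cancel_left p two_pos]
  · intro d hd hd2
    obtain ⟨hdvd, hlt⟩ := Nat.mem_properDivisors.1 hd
    obtain ⟨d₁, d₂, h₁, h₂, rfl⟩ := Nat.dvd_mul.1 hdvd
    rcases (Nat.dvd_prime Nat.prime_two).1 h₁ with rfl | rfl <;>
      rcases (Nat.dvd_prime hp).1 h₂ with rfl | rfl
    · simp
    · simp [coef_prime hp hodd, term_zero]
    · simp at hd2
    · omega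
  · intro h
    exact absurd (Nat.mem_properDivisors.2 ⟨dvd_mul_right 2 p, by omega⟩) h

/-- `c (2p) ≠ 0` for every odd prime `p` (indeed `c (2p) = q^p − q^{2p−1}`). -/
theorem coef_two_mul_prime_ne_zero {p : ℕ} (hp : p.Prime) (hodd : ¬ 2 ∣ p) : coef (2 * p) ≠ 0 := by
  have hp3 : 3 ≤ p := by
    have := hp.two_le
    rcases Nat.lt_or_ge p 3 with h | h
    · interval_cases p; exact absurd (dvd_refl 2) hodd
    · exact h
  have hoddp : Odd p := Nat.odd_iff.mpr (Nat.two_dvd_ne_zero.mp hodd)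
  rw [coef_eq (by omega), ringSum_two_mul_prime hp hodd, term, udir_coef_two, coef_two, norm_neg,
    Complex.norm_real, Real.norm_eq_abs, abs_of_pos q_pos, hoddp.neg_one_pow, seedMom,
    if_pos (dvd_mul_right 2 p)]
  have hq : (q : ℂ) ≠ 0 := by exact_mod_cast q_ne_zero
  intro h
  rw [neg_eq_zero, div_eq_zero_iff, or_iff_left hq] at h
  -- `q^{2p} - q^{p+1} = 0` is impossible since `q < 1`
  have h' : (q : ℂ) ^ (2 * p) = (q : ℂ) ^ (p + 1) := by linear_combination h
  have h'' : q ^ (2 * p) = q ^ (p + 1) := by exact_mod_cast h'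
  have hlt : q ^ (2 * p) < q ^ (p + 1) := pow_lt_pow_right_of_lt_one₀ q_pos q_lt_one (by omega)
  exact hlt.ne h''

/-- There are live rings of arbitrarily large index. -/
theorem exists_live_gt (B : ℕ) : ∃ n, B < n ∧ coef n ≠ 0 := by
  obtain ⟨p, hp, hprime⟩ := Nat.exists_infinite_primes (max B 3)
  have hodd : ¬ 2 ∣ p := by
    intro h
    have := (Nat.dvd_prime hprime).1 h
    omega
  exact ⟨2 * p, by omega, coef_two_mul_prime_ne_zero hprime hodd⟩

end

end Summit.RiemannHypothesis.RiemannHypothesis.Theorems.Splittings.ScrewWolffDiscreteData
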